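import Mathlib.Analysis.InnerProductSpace.Calculus
import Mathlib.Analysis.InnerProductSpace.PiL2
import Mathlib.Analysis.Convex.Function
import Mathlib.Analysis.Calculus.ContDiff.Defs
import Literature.MathematicalPhysics.KineticTheory.HardSphereEuler
import HarnessLib

/-!
# Barrier catalogue `AtomisticToContinuum` / `HydrodynamicLimit`: large velocities in the
relative entropy method (bounded-gradient kinetic energy / the "high-momentum cutoff")

`Literature/Barriers/AtomisticToContinuum/HighMomentumCutoff.lean` (D-0021 barrier file; one
barrier, main declaration `HighMomentumCutoffBarrier` — the printed scope restriction, proved —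
carrying the structured BARRIER block; auxiliary OPEN hypothesis `HighMomentumCutoff σ` whose
truth would EVADE the barrier).

## The obstruction as printed

* Olla–Varadhan–Yau 1993, §1 (Comm. Math. Phys. 155, p. 525): "The second modification is
  needed because we cannot handle the large velocities that might arise in our problem. We do
  not have effective truncation techniques. This forces us to modify the kinetic energy part
  `½ ∑ (pₐⁱ)²` to a function `φ(p)` which has a bounded gradient, thereby making the velocities
  uniformly bounded. A good example to keep in mind is the relativistic kinetic energy ... In the
  classical limit as `c → ∞`, `φ(p)` becomes the classical kinetic energy." §2.1, hypothesis
  (iii) of (2.2) (p. 526), on the kinetic energy `φ` in the Hamiltonian (2.1)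
  `H = ∑ φ(pₐ) + ½ ∑ V((xₐ - x_β)/ε)`: "`φ ∈ C²(ℝ³)`, strictly convex and
  `|∂²φ/∂pⁱ∂pʲ| ≤ c''` for all `p`, `|∂φ/∂pⁱ| ≤ c'`". Their Theorem 2.1 (Euler limit in the
  smooth regime, with weak noise) is stated for this class; the classical `φ(p) = |p|²/2` is
  recovered only "in the classical limit `c → ∞`" of the example, which the theorem does not take.
* Nachtergaele–Yau 2003, §2.3 (continuum fermions, Schrödinger dynamics), Assumption II.1
  ("High-momentum cutoff assumption"): with `N_p(t)` the momentum occupation of the evolved local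
  equilibrium state, "there is a constant `c > 0` such that for all `t ≤ T₀/ε`,
  `ε^d ∫ dp e^{c p²} N_p(t) ≤ C_{T₀}`". Printed comments: "There is however no proof for the
  cut-off assumption 1 even in the classical case. (In [OVY], the usual quadratic kinetic energy
  was replaced by one with bounded derivatives with respect to momentum. So the cut-off
  assumption 1 is not needed too.)"; "The cutoff assumptions are technical in nature. For Fermion
  models on a lattice instead of in the continuum, no cut-off assumptions are required."
  Their Theorem 2.1 is conditional on II.1.

## Formal content

* `IsOVYKineticEnergy φ` — hypothesis (2.2)(iii) of Olla–Varadhan–Yau as an explicit class of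
  kinetic energies on a real normed space (`C²`, strictly convex, bounded Hessian, bounded
  gradient; norm form of the printed componentwise bounds): the SCOPE of the printed theorem.
* `HighMomentumCutoffBarrier` (main declaration, proved in `HighMomentumCutoffBarrier_holds`):
  the classical kinetic energy `p ↦ |p|²/2` on `ℝ³` is not in that class — its gradient `p` is
  unbounded (`norm_le_norm_fderiv_classicalKineticEnergy`) — so OVY's Theorem 2.1 as printed does
  not cover the true kinetic energy of hard spheres (or of any classical particle system).
  Polarity: proving the Prop CONFIRMS the barrier (it is the printed scope exclusion).
* `HighMomentumCutoff σ` (auxiliary, OPEN, asserted nowhere): the transcription (ours; the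
  source states it for continuum fermions) of Nachtergaele–Yau's Assumption II.1 to the
  conjunct's hard-sphere setting on the tree's vocabulary (`HardSphereEuler.lean`): in
  macroscopic units (`ε^d ∑ₚ ↔ (N+1)⁻¹ ∑ᵢ`, `t ≤ T₀/ε` microscopic `↔ t ∈ [0, T]` macroscopic),
  for some `c > 0` and `C < ∞`, for all `N` and `t ∈ [0, T]`,
  `𝔼_{λ^N}[(N+1)⁻¹ ∑ᵢ exp(c |vᵢ(t)|²)] ≤ C` along the deterministic hard-sphere flow started from
  the local Gibbs law. Polarity: a proof of `HighMomentumCutoff σ` would EVADE the barrier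
  (evasion (iii) made unconditional); it is the missing input, not the obstruction.

## References

* S. Olla, S. R. S. Varadhan, H.-T. Yau, Comm. Math. Phys. 155 (1993) 523–560, §1 p. 525,
  §2.1 (2.1)–(2.2), Thm 2.1.
* B. Nachtergaele, H.-T. Yau, Comm. Math. Phys. 243 (2003) 485–540 (arXiv:math-ph/0209027),
  §2.3 Assumption II.1 and the comments following Assumption III; Thm 2.1.
* G. Canestrari, C. Liverani, S. Olla, Invent. Math. (2026), §1 (arXiv:2310.13338 p. 3)
  (context: diffusive limits).
* S. R. S. Varadhan, *Entropy methods in hydrodynamic scaling*, LNM 1551 (1993) 112–145, §5;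
  N. Braxmeier-Even, S. Olla, Arch. Ration. Mech. Anal. 213 (2014) 561–585, §1; L. Saint-Raymond,
  LNM 1971 (2009), §5.1.4, §5.4.2 (barrier audit 2026-08-15: scope_caveats (f), evasions (iv)–(v);
  companion `HighMomentumCutoffNarrow.lean`).
-/

noncomputable section

open MeasureTheory Set
open scoped ENNReal RealInnerProductSpace

namespace Literature.Barriers.AtomisticToContinuum

open Literature.Analysis.FluidPDE Literature.MathematicalPhysics.KineticTheory

section OVYClass

variable {E : Type*} [NormedAddCommGroup E]

/-- **Olla–Varadhan–Yau's hypothesis (2.2)(iii) on the kinetic energy** `φ` of the Hamiltonian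
`H = ∑ₐ φ(pₐ) + ½ ∑ V((xₐ - x_β)/ε)`: `φ ∈ C²`, strictly convex, with bounded second derivatives
and BOUNDED GRADIENT ("thereby making the velocities `ẋ = ∇φ(p)` uniformly bounded"). Printed on
`ℝ³` with componentwise bounds `|∂²φ/∂pⁱ∂pʲ| ≤ c''`, `|∂φ/∂pⁱ| ≤ c'`; rendered here, on any real
normed space, by operator-norm bounds on `D²φ` and `Dφ` (equivalent up to dimensional constants
in finite dimension). This is the scope of OVY's Theorem 2.1 — the technique class of the barrier.
[cite: OllaVaradhanYau1993, §2.1 (2.2)(iii) and §1 p. 525] -/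
structure IsOVYKineticEnergy [NormedSpace ℝ E] (φ : E → ℝ) : Prop where
  contDiff : ContDiff ℝ 2 φ
  strictConvexOn : StrictConvexOn ℝ univ φ
  hessian_bounded : ∃ C : ℝ, ∀ p, ‖iteratedFDeriv ℝ 2 φ p‖ ≤ C
  fderiv_bounded : ∃ C : ℝ, ∀ p, ‖fderiv ℝ φ p‖ ≤ C

/-- The classical (Newtonian, unit mass) kinetic energy `φ(p) = |p|²/2` — the kinetic energy of
the hard-sphere system of the conjunct, and the `c → ∞` limit of OVY's relativistic example.
[cite: OllaVaradhanYau1993, §1 p. 525] -/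
def classicalKineticEnergy (p : E) : ℝ := ‖p‖ ^ 2 / 2

/-- Unfolding. [cite: OllaVaradhanYau1993, §1 p. 525] -/
theorem classicalKineticEnergy_def (p : E) : classicalKineticEnergy p = ‖p‖ ^ 2 / 2 := rfl

variable [InnerProductSpace ℝ E]

/-- The velocity of the classical kinetic energy is the momentum: `Dφ(p)·p = |p|²`
(`∇(|p|²/2) = p`). [folklore] -/
theorem fderiv_classicalKineticEnergy_apply_self (p : E) :
    fderiv ℝ (classicalKineticEnergy (E := E)) p p = ‖p‖ ^ 2 := by
  have h1 : HasFDerivAt (fun q : E => ‖q‖ ^ 2) (2 • innerSL ℝ p) p :=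
    (hasStrictFDerivAt_norm_sq p).hasFDerivAt
  have h2 : HasFDerivAt (fun q : E => (1 / 2 : ℝ) * ‖q‖ ^ 2) ((1 / 2 : ℝ) • (2 • innerSL ℝ p)) p :=
    h1.const_mul (1 / 2 : ℝ)
  have hfun : (classicalKineticEnergy (E := E)) = fun q => (1 / 2 : ℝ) * ‖q‖ ^ 2 := by
    funext q; rw [classicalKineticEnergy_def]; ring
  rw [hfun, h2.fderiv]
  simp only [FunLike.coe_smul, Pi.smul_apply, innerSL_apply_apply, smul_eq_mul,
    real_inner_self_eq_norm_sq]
  ring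

/-- The gradient of the classical kinetic energy dominates the momentum in norm:
`|p| ≤ ‖Dφ(p)‖` (in fact equality) — velocities are NOT uniformly bounded. [folklore] -/
theorem norm_le_norm_fderiv_classicalKineticEnergy (p : E) :
    ‖p‖ ≤ ‖fderiv ℝ (classicalKineticEnergy (E := E)) p‖ := by
  rcases eq_or_ne p 0 with rfl | hp
  · simp
  have hpos : 0 < ‖p‖ := norm_pos_iff.2 hp
  have hle : ‖p‖ ^ 2 ≤ ‖fderiv ℝ (classicalKineticEnergy (E := E)) p‖ * ‖p‖ := by
    calc ‖p‖ ^ 2 = fderiv ℝ (classicalKineticEnergy (E := E)) p p :=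
          (fderiv_classicalKineticEnergy_apply_self p).symm
      _ ≤ ‖fderiv ℝ (classicalKineticEnergy (E := E)) p p‖ := Real.le_norm_self _
      _ ≤ ‖fderiv ℝ (classicalKineticEnergy (E := E)) p‖ * ‖p‖ := ContinuousLinearMap.le_opNorm _ _
  rw [sq] at hle
  exact le_of_mul_le_mul_right hle hpos

/-- **The classical kinetic energy violates OVY's bounded-gradient clause**: on a nontrivial real
inner product space there is no `C` with `‖D(|p|²/2)‖ ≤ C` for all `p`.
[cite: OllaVaradhanYau1993, §1 p. 525 and §2.1 (2.2)(iii)] -/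
theorem not_bounded_fderiv_classicalKineticEnergy [Nontrivial E] :
    ¬ ∃ C : ℝ, ∀ p : E, ‖fderiv ℝ (classicalKineticEnergy (E := E)) p‖ ≤ C := by
  rintro ⟨C, hC⟩
  obtain ⟨p₀, hp₀⟩ := exists_ne (0 : E)
  have hp₀' : 0 < ‖p₀‖ := norm_pos_iff.2 hp₀
  set p : E := ((|C| + 1) / ‖p₀‖) • p₀ with hp
  have hnorm : ‖p‖ = |C| + 1 := by
    rw [hp, norm_smul, Real.norm_eq_abs, abs_of_nonneg (by positivity),
      div_mul_cancel₀ _ hp₀'.ne']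
  have : ‖p‖ ≤ C := (norm_le_norm_fderiv_classicalKineticEnergy p).trans (hC p)
  rw [hnorm] at this
  linarith [le_abs_self C]

/-- Hence the classical kinetic energy is not an OVY kinetic energy (on any nontrivial real inner
product space, in particular on `ℝ³`). [cite: OllaVaradhanYau1993, §2.1 (2.2)(iii)] -/
theorem not_isOVYKineticEnergy_classical [Nontrivial E] :
    ¬ IsOVYKineticEnergy (classicalKineticEnergy (E := E)) :=
  fun h => not_bounded_fderiv_classicalKineticEnergy h.fderiv_bounded

end OVYClass

/-- The empirical exponential velocity moment of an `N`-particle configuration at parameter `c`: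
`N⁻¹ ∑ᵢ exp(c |vᵢ|²)` (as an extended non-negative real; the summands are `≥ 1`). This is the
observable whose expectation Nachtergaele–Yau's high-momentum cutoff assumption bounds
(`ε^d ∫ dp e^{cp²} N_p`). [cite: NachtergaeleYau2003, §2.3 Assumption II.1] -/
def expVelocityMoment {N : ℕ} {d : Type*} [Fintype d] {X : Type*} (c : ℝ) (z : Config N d X) : ℝ≥0∞ :=
  ENNReal.ofReal ((N : ℝ)⁻¹ * ∑ i, Real.exp (c * ‖(z i).2‖ ^ 2))

/-- The summand form: `expVelocityMoment c z = ofReal (N⁻¹ ∑ᵢ exp(c |vᵢ|²))` (unfolding).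
[cite: NachtergaeleYau2003, §2.3 Assumption II.1] -/
theorem expVelocityMoment_eq {N : ℕ} {d : Type*} [Fintype d] {X : Type*} (c : ℝ) (z : Config N d X) :
    expVelocityMoment c z = ENNReal.ofReal ((N : ℝ)⁻¹ * ∑ i, Real.exp (c * ‖(z i).2‖ ^ 2)) :=
  rfl

/-- At `c = 0` the moment is `1` for `N ≥ 1` particles (sanity/unfolding check). [folklore] -/
theorem expVelocityMoment_zero {N : ℕ} {d : Type*} [Fintype d] {X : Type*} (hN : N ≠ 0) (z : Config N d X) :
    expVelocityMoment 0 z = 1 := by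
  have hN' : (N : ℝ) ≠ 0 := by exact_mod_cast hN
  simp [expVelocityMoment, hN']

/-- **High-momentum cutoff for hard spheres at reduced density `σ` — auxiliary OPEN hypothesis,
asserted nowhere; its truth would EVADE the barrier `HighMomentumCutoffBarrier`, its failure for
some `σ` in the conjunct's range would sharpen it.** For all continuous local-equilibrium profiles
`a₀, θ₀ > 0`, `u₀`, every macroscopic horizon `T > 0` and every family of hard-sphere flows `Φ_N`
of `N + 1` spheres of diameter `σ (N+1)^{-1/3}` on `𝕋³`, there are `c > 0` and `C < ∞` such that
for all `N` and all `t ∈ [0, T]` the expected empirical exponential velocity moment of the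
deterministically evolved configuration under the local Gibbs initial law is at most `C`:
`∫ (N+1)⁻¹ ∑ᵢ exp(c |vᵢ(Φ_N(t) z)|²) dλ^N_{σ,a₀,u₀,θ₀}(z) ≤ C`. Transcription (ours) of
Nachtergaele–Yau's Assumption II.1 — printed for continuum fermions, "no proof ... even in the
classical case" — to the conjunct's hard-sphere setting; only meaningful for `σ` in the conjunct's
small-density range (for `σ` beyond close packing the local Gibbs law `Kinetic.localGibbsLaw` is
eventually the zero measure by the junk value `0` of `Kinetic.canonicalDensity`, and the bound is
vacuous). [cite: NachtergaeleYau2003, §2.3 Assumption II.1] -/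
def HighMomentumCutoff (σ : ℝ) : Prop :=
  ∀ (a₀ θ₀ : T3 → ℝ) (u₀ : T3 → V3), Continuous a₀ → Continuous θ₀ → Continuous u₀ →
    (∀ x, 0 < a₀ x) → (∀ x, 0 < θ₀ x) → ∀ T : ℝ, 0 < T →
    ∀ Φ : (N : ℕ) → HardSphereFlow (Torus.geometry (Fin 3)) (hsDiameter σ N) (N + 1),
      ∃ c : ℝ, 0 < c ∧ ∃ C : ℝ≥0∞, C < ∞ ∧ ∀ N : ℕ, ∀ t ∈ Icc 0 T,
        ∫⁻ z, expVelocityMoment c ((Φ N).flow t z) ∂(localGibbsLaw σ a₀ u₀ θ₀ N (Φ N)) ≤ C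

/-- Monotonicity in the horizon: the cutoff on `[0, T]` implies it on `[0, T']` for
`0 < T' ≤ T` (bookkeeping lemma). [cite: NachtergaeleYau2003, §2.3 Assumption II.1] -/
theorem HighMomentumCutoff.mono_horizon {σ : ℝ} (h : HighMomentumCutoff σ)
    (a₀ θ₀ : T3 → ℝ) (u₀ : T3 → V3) (ha : Continuous a₀) (hθ : Continuous θ₀)
    (hu : Continuous u₀) (ha0 : ∀ x, 0 < a₀ x) (hθ0 : ∀ x, 0 < θ₀ x) {T T' : ℝ} (hT' : 0 < T')
    (hTT' : T' ≤ T)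
    (Φ : (N : ℕ) → HardSphereFlow (Torus.geometry (Fin 3)) (hsDiameter σ N) (N + 1)) :
    ∃ c : ℝ, 0 < c ∧ ∃ C : ℝ≥0∞, C < ∞ ∧ ∀ N : ℕ, ∀ t ∈ Icc 0 T',
      ∫⁻ z, expVelocityMoment c ((Φ N).flow t z) ∂(localGibbsLaw σ a₀ u₀ θ₀ N (Φ N)) ≤ C := by
  obtain ⟨c, hc, C, hC, hb⟩ := h a₀ θ₀ u₀ ha hθ hu ha0 hθ0 T (hT'.trans_le hTT') Φ
  exact ⟨c, hc, C, hC, fun N t ht => hb N t ⟨ht.1, ht.2.trans hTT'⟩⟩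

/-- **Barrier: the relative entropy derivation of Euler from (noisy) Hamiltonian particles is
printed only for kinetic energies with bounded gradient (bounded velocities); for the true
kinetic energy `|p|²/2` it needs a high-momentum cutoff bound along the evolution for which no
proof exists "even in the classical case".**

Formal kernel (this `Prop`, proved in `HighMomentumCutoffBarrier_holds`): the classical kinetic
energy `p ↦ |p|²/2` on `ℝ³` (`classicalKineticEnergy` on `V3 = EuclideanSpace ℝ (Fin 3)`, the
velocity space of the conjunct) does not satisfy hypothesis (2.2)(iii) of Olla–Varadhan–Yau
(`IsOVYKineticEnergy`: `C²`, strictly convex, bounded Hessian, bounded gradient): its gradient is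
the identity, `‖D(|p|²/2)‖ ≥ |p|`, unbounded. So OVY's Theorem 2.1, as printed, excludes the
kinetic energy of every classical (in particular hard-sphere) system; the classical case is only
the un-taken limit `c → ∞` of their relativistic example. [cite: OllaVaradhanYau1993, §1 p. 525 and §2.1 (2.2)(iii), Thm 2.1]

BARRIER
technique_class: relative-entropy entropy-method (Yau's relative entropy method as implemented for continuum particle systems by Olla–Varadhan–Yau and Nachtergaele–Yau; scope = `IsOVYKineticEnergy`)
blocks: `HydrodynamicLimit` for the true kinetic energy `|v|²/2` (hard spheres: the conjunct fixes the deterministic dynamics, so the kinetic energy cannot be modified — crux `LargeVelocityControl` of routes RelEntropyErgodic/VanishingNoise) by the printed relative entropy theorems: OVY's Theorem 2.1 is stated only for kinetic energies `φ` in the class (2.2)(iii) with bounded gradient, "thereby making the velocities uniformly bounded" [cite: OllaVaradhanYau1993, §1 p. 525 and §2.1 (2.2)(iii)], which excludes `|p|²/2` (this kernel); with the quadratic kinetic energy the method as carried out by Nachtergaele–Yau is conditional on the high-momentum cutoff II.1 (`HighMomentumCutoff`), and "There is however no proof for the cut-off assumption 1 even in the classical case" [cite: NachtergaeleYau2003,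 §2.3].
because: "we cannot handle the large velocities that might arise in our problem. We do not have effective truncation techniques. This forces us to modify the kinetic energy ... to a function `φ(p)` which has a bounded gradient" [cite: OllaVaradhanYau1993, §1 p. 525]; Nachtergaele–Yau isolate the missing input as the uniform Gaussian-moment bound II.1, `ε^d ∫ dp e^{cp²} N_p(t) ≤ C_{T₀}` for `t ≤ T₀/ε` along the true evolution from local equilibrium, and note that OVY avoid it only by the bounded-derivative kinetic energy [cite: NachtergaeleYau2003, §2.3 Assumption II.1 and comments after Assumption III].
evasions_known: (i) modify the kinetic energy to one with bounded gradient (e.g. relativistic), making velocities bounded — Euler limit in the smooth regime with weak noise [cite: OllaVaradhanYau1993, §1 p. 525, (2.2) and Thm 2.1]; (ii) lattice models: "For Fermion models on a lattice instead of in the continuum, no cut-off assumptions are required" [cite: NachtergaeleYau2003, §2.3]; (iii) assume the bound: Euler derivation conditional on II.1 [cite: NachtergaeleYau2003, Thm 2.1] — in the tree, a proof of the open hypothesis `HighMomentumCutoff σ` would make (iii) unconditional for hard spheres and thereby evade this barrier; (iv) (audit 2026-08-15) keep `p²/2` and unbounded Gaussian momenta but remove the CONVECTIVE energy transport: for the anharmonic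 chain in Lagrangian coordinates (energy conserved, momentum-exchange noise) the currents `(p, V'(r), pV'(r))` are "bounded by the energy" and the same relative entropy method gives the Euler limit in the smooth regime — "our energy current does not have the cubic convecting term. This allows us to work with the usual quadratic kinetic energy" [cite: BraxmeierEvenOlla2014, §1 and §2 Main Theorem]; (v) (audit 2026-08-15) at the kinetic (Boltzmann → Euler) level the analogous a priori tail estimate ((5.19)) is assumed of the solutions and discharged for classical near-equilibrium solutions by an independent energy method [cite: SaintRaymond2009, §5.1.4 Prop. 5.1.10 and Thm 5.1.11]. None published for continuum classical particles with `|v|²/2` and conserved, convected energy, in particular hard spheres [cite: NachtergaeleYau2003, §2.3].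
scope_caveats: (a) the sources print NO impossibility theorem: the printed content is a scope restriction (OVY (2.2)(iii), formalised and proved here as the exclusion of `|p|²/2`) and an unproved hypothesis (NY II.1: "no proof", not "false"); nothing printed says the relative entropy method cannot be made to work with quadratic kinetic energy [cite: OllaVaradhanYau1993, §1 p. 525] [cite: NachtergaeleYau2003, §2.3]; (b) verbatim scope: OVY treat smooth superstable pair potentials with weak momentum-exchange noise on `𝕋³`, Nachtergaele–Yau continuum fermions under Schrödinger dynamics (II.1 is printed for the fermionic momentum occupation `N_p(t)`); `HighMomentumCutoff σ` is this file's transcription to deterministic hard spheres at reduced density `σ`, covered by neither text as printed [cite: OllaVaradhanYau1993, §2.1] [cite: NachtergaeleYau2003, §2.3]; (c) `HighMomentumCutoff σ` is only meaningful for `σ` in the conjunct's small-density range (`Kinetic.HydrodynamicLimitFor σ`, `0 < σ < σ₀`): for `σ` beyond close packing the local Gibbs law is eventually the zero measure (junk value of `Kinetic.canonicalDensity`) and the bound holds vacuously; (d) the remark "known methods often rely on entropy estimates that fail to control quadratic non-linearities (in particular energy)" [cite: CanestrariLiveraniOlla2026, §1 (arXiv:2310.13338 p. 3)] is printed about DIFFUSIVE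 (heat-conduction) limits, "even for stochastic dynamics", not about the hyperbolic relative entropy method, and is recorded only as context; (e) `IsOVYKineticEnergy` renders the printed componentwise bounds by operator norms (equivalent on `ℝ³` up to constants) and is stated on any real normed space; (f) NARROWED by the barrier audit of 2026-08-15 (companion `HighMomentumCutoffNarrow.lean`, `HighMomentumCutoffBarrierNarrow`, all conjuncts proved): the `technique_class` "scope = `IsOVYKineticEnergy`" and the `because` "velocities uniformly bounded" name OVY's SUFFICIENT condition, not the obstruction — the printed mechanism is that the convective ENERGY current `p|p|²/2` is cubic and "the cubic exponent is bad news even for the Gaussian" [cite: Varadhan1993EntropyMethods, §5], i.e. `∫_{|p|>M} exp(γ|p|³ - |p|²/(2θ)) dp = ∞` for all `θ, γ > 0` and every cut-off level `M` (proved there), so the entropy-inequality truncation of Lemma 3.7 is unavailable, while mass/momentum currents (at most quadratic) and bounded-gradient energy currents (linear growth, "Microscopic currents of the conserved quantities should be bounded by the energy of the system" [cite: BraxmeierEvenOlla2014, §1]) are inside the method; unbounded velocity per se is NOT the obstruction (evasion (iv)); for the conjunct (hard spheres: energy conserved and convected) the barrier applies unchanged, and what it asks for is an a priori velocity-tail bound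 along the true evolution decaying faster than every exponential in the cut-off level ("we need the error term stemming from the high-momentum cutoff to be smaller than `e^{-CM}` for any `C > 0` … This is guaranteed by the Maxwellian bound in the cutoff assumption II.1" [cite: NachtergaeleYau2003, §7.2]) — NY's Gaussian form II.1 / `HighMomentumCutoff σ`; NB an exponential moment of ORDER `N` of the cubic current itself (`N⁻¹ log E[exp(λ ∑ χ(x_i)|v_i|³)] ≤ C`, the informal wording of crux stmt-AtomisticToContinuum-0781) is infinite already under the local Gibbs initial law for any `λ > 0`, `χ ≥ 0`, `χ ≢ 0`.
status: established (printed scope restriction; formal kernel a theorem, proved here; the auxiliary `HighMomentumCutoff σ` is an open hypothesis asserted nowhere, with evasion polarity)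
-/
def HighMomentumCutoffBarrier : Prop :=
  ¬ IsOVYKineticEnergy (classicalKineticEnergy (E := V3))

/-- Discharge of the formal kernel: `|p|²/2` on `ℝ³` has unbounded gradient, hence violates
OVY's (2.2)(iii). [cite: OllaVaradhanYau1993, §2.1 (2.2)(iii)] -/
theorem HighMomentumCutoffBarrier_holds : HighMomentumCutoffBarrier :=
  not_isOVYKineticEnergy_classical

/-- The kernel in every dimension: for any finite nonempty index type `d`, `|p|²/2` on
`EuclideanSpace ℝ d` is not an OVY kinetic energy. [cite: OllaVaradhanYau1993, §2.1 (2.2)(iii)] -/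
theorem HighMomentumCutoffBarrier.euclideanSpace (d : Type*) [Fintype d] [Nonempty d] :
    ¬ IsOVYKineticEnergy (classicalKineticEnergy (E := EuclideanSpace ℝ d)) :=
  not_isOVYKineticEnergy_classical

end Literature.Barriers.AtomisticToContinuum

end
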